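import Summits.QuantumFields.BalabanUV.Beta.FP.KernelStepDressingHessKer
import Summits.QuantumFields.BalabanUV.Beta.NVertexWoundPeriodised
import Summits.QuantumFields.BalabanUV.Beta.NVertexParities
import Summits.QuantumFields.BalabanUV.Beta.FP.NestedConstraintScaling
import Literature.MathematicalPhysics.QuantumFieldTheory.Balaban1983to89.Beta.BalabanStepJetsSucc
import Summits.QuantumFields.BalabanUV.Beta.FP.TowerSigmaLegLetters

/-!
# `BalabanUV.Beta.FP.TowerFTransportRow` — road «FP», binder row D1, ROUTE T (β1), (H5-F)∕(H6): **THE END's TRANSPORT ROW `htr` BY NAME** — at the per-storey choice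
# `AF (j+1) := σ•AN ctr j`, `𝒱F (j+1) := σ′•(Lc⁴ • dressV (Lc^(j+1)) Lc (wStep Lc (j+1)) (VN ctr Pn j))`, `𝒲F (j+1) := σ′•(Lc⁸ • dressW (Lc^(j+1)) Lc (wStep Lc (j+1)) (WN ctr Pn j))`
# (`σ = 1 ⊕ u⁻¹`, `σ′ = 1 ⊕ u`), the F-system's resolvent Hessian kernel IS `Lc⁸ · dressedEntry (wStep Lc (j+1)) (hessKer (AN ctr j) (VN ctr Pn j) (WN ctr Pn j)) (Lc•z)` —
# v10 `StepRecursionFeedNestedNamedI`'s binder `htr` (L.277) CHARACTER FOR CHARACTER under that σ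

WHY (located).  an2 g79 J-NOTE-23 proper §3 (H5-F)∕(H6): «`htr`'s shape … the kernel-level dressing `K ↦ K^{dressed}` … is not in the tree by name»; road g57 SPEC-64 §17 (2);
road g58 A-2 l.68977 (c), RCPT-P5 l.68984 (d)(iii), STAGED-3 l.68988.  FILES 1–2 (`KernelStepDressing`, `KernelStepDressingHessKer`) typed the dressing and the identity
generically; THIS FILE junctions it with the record: the leg's letters are an2's `NVertexSectors.decays_AN` and `NVertexWoundPeriodised.shiftK_AN`, the families' letters
an2's `NVertexParities.vertexFamilies_VN_WN` and — for the block covariance — `ChartStepJets.SchartOf_translate ∕ WchartOf_translate` (the record's (TV)(TH)(TM)(TB)(Tmix) + (TG))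
through lit `BalabanStepJetsSucc.vertexOfK_translate_block`; the column's decay is lit `OneStepKernelFamily.decays_KInvStep` (`wStep Lc j κ l p = Lc^{5j} · KInvStep Lc j (−p) 0 (inl κ) (inr l)`);
the units leave `hessKer` by lit `HessKerRate.hessKer_scaleK` (`σ·σ′ = 1`, road `NestedConstraintScaling.fibreScale_mul_inv`), the powers of `Lc` by lit `KernelReflection.bubble_smul_left ∕
_right ∕ tadpole_smul` (bubble bilinear, tadpole linear: `Lc⁴·Lc⁴ = Lc⁸`).

WHAT ([folklore] composition BY NAME; no `def`, no `def … : Prop`, nothing cited, 0 sorry).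
* §1 record letters: `abs_wStep_le` (column decay), `shiftK_AN_smul` (block invariance in the `+N•s` spelling), `VN_translate` ∕ `WN_translate` (block covariance of an2's families).
* §3 **`exists_vertexFamilies_FRec`** — the σ′-scaled dressed families are `VertexFamily ∕ VertexFamily₂` at blocking `Lc^(j+1)·Lc` with one common rate (v10's
  `hVF hWF hδF` in `∃`-form, the END feeding `NF CvF CwF δF` by `Classical.choose`).
* §2 **`htr_rec`** — v10's `htr` under σ = {`(AF (j + 1))` ↦ the σ-chart, `(𝒱F (j + 1))` ↦ the σ′-scaled `Lc⁴ • dressV …`, `(𝒲F (j + 1))` ↦ the σ′-scaled `Lc⁸ • dressW …`}, for any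
  unit sequence `uF` with `uF j ≠ 0`, every `j` (the binder's `1 ≤ j` is carried and not used).
WHAT THIS IS NOT: not `hF₁` (the depth-1 literal anchor: `TshotOf Lc (JcComp …) 1` is the (III′) ONE-SHOT literal `JcOf … 1`, not `(AN 0, VN 0, WN 0)` — a separate junction);
not the F-family's periodised letters `hVFm hVFt hWFm hWFt hHF₁ hQF₁ hHF₂ hQF₂ hWFw` (box side; the END keeps them displayed for these `𝒱F 𝒲F`); nothing of Bałaban's asserted, valued or discharged; 0 estimates; v10 ∕ END NOT filed (policy); 0∕4 row-D1 binders; NOT (C1), NOT (T-ID), NOT D1, NEVER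
«G-an2-4 closed», NOT BetaPertH, NOT continuum, NOT Clay.
HONEST DEPENDENCY (page 1, mandatory): continuum YM on T⁴ ⇐ BetaPertH ∧ nine spine estimates (0/9 proved); BetaPertH ⇐ (D1) ∧ (D4) ∧ CAP+tail;
G-an2-4 gates asym, D1 and NE2/3/4.  HONEST FRAMING (cell contract, verbatim): «discharging `BetaPertH` makes Bałaban's UV stability UNCONDITIONAL —
a real constructive-QFT result; it is NOT the continuum limit and NOT the Clay problem.»  ABSOLUTE RULE (cell charter, verbatim): «No internally-minted
statement may enter as a cited fact. Every hypothesis is either kernel-proved in this package or a verbatim quotation of a PUBLISHED theorem with page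
reference. The manuscript(s) under audit are NOT citable for their own disputed steps — they are the thing under adjudication; programme-internal
(2001/route/tribunal) claims are never citable.»  Road «FP» OWNER, b2b-balaban-beta-d1-p3 gen 58, 2026-08-29.  No existing file touched.
-/

noncomputable section

open scoped BigOperators

namespace Summit.QuantumFields.BalabanUV.Beta.FP.TowerFTransportRow

open Finset
open Literature.MathematicalPhysics.QuantumFieldTheory
open Literature.MathematicalPhysics.QuantumFieldTheory.Balaban1983to89
open Literature.MathematicalPhysics.QuantumFieldTheory.Balaban1983to89.Beta
open B12Sec2to5 (l1 l1_nonneg)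
open ExpKernelCalculus (Site MKer Decays BiLoc VertexFamily VertexFamily₂ shiftK hessKer bubble tadpole)
open DressedMomentNormalisation (EKer dressedEntry)
open HessKerRate (scaleK hessKer_scaleK biLoc_scaleK)
open SecondOrderResponse (biLoc_smul)
open KernelReflection (bubble_smul_left bubble_smul_right tadpole_smul)
open HessianTelescopingKKT (wStep)
open OneStepResolventKernel (Fib)
open OneStepKernelFamily (KInvStep decays_KInvStep)
open BalabanStepJetsSucc (vertexOfK_translate_block)
open Summit.QuantumFields.BalabanUV.Beta.TameKernelCalculus (Spr biLoc_of_le)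
open Summit.QuantumFields.BalabanUV.Beta.AxialDressingRooted (one_le_of_neZero)
open Summit.QuantumFields.BalabanUV.Beta.CompositeOneShotJets (tabsComp)
open Summit.QuantumFields.BalabanUV.Beta.CompositeOneShotJetData (Roots Pins AN VN WN AN_eq VN_eq WN_eq JNat JNat_S JNat_W)
open Summit.QuantumFields.BalabanUV.Beta.NVertexSectors (decays_AN)
open Summit.QuantumFields.BalabanUV.Beta.NVertexWoundPeriodised (shiftK_AN)
open Summit.QuantumFields.BalabanUV.Beta.NVertexParities (vertexFamilies_VN_WN)
open Summit.QuantumFields.BalabanUV.Beta.ChartStepJets (SchartOf_translate WchartOf_translate)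
open Summit.QuantumFields.BalabanUV.Beta.FP.NestedConstraintScaling (fibreScale_mul_inv)
open Summit.QuantumFields.BalabanUV.Beta.FP.KernelStepDressing (dressV dressW vertexFamily_dressV vertexFamily₂_dressW)
open Summit.QuantumFields.BalabanUV.Beta.FP.TowerSigmaLegLetters (abs_fibSigma'_le)
open Summit.QuantumFields.BalabanUV.Beta.FP.KernelStepDressingHessKer (hessKer_dressV_dressW)

/-! ## §1 The record's letters in FILE 2's hypothesis shapes -/

section Letters

variable (Lc : ℕ) [NeZero Lc]

/-- [folklore] **THE STEP COLUMN's ENTRIES DECAY FROM THE ORIGIN**: `|wStep Lc j κ l p| ≤ Lc^{5j}·C · e^{−δ|p|₁}` (lit `decays_KInvStep`; `wStep … p` reads the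
packed step resolvent at `(−p, 0)`). -/
theorem abs_wStep_le (j : ℕ) : ∃ δ C : ℝ, 0 < δ ∧ 0 ≤ C ∧ ∀ (κ l : Fin (3 + 1)) (p : Fin (3 + 1) → ℤ), |wStep Lc j κ l p| ≤ C * Real.exp (-δ * l1 p) := by
  obtain ⟨δ, C, hδ, hC, hK⟩ := decays_KInvStep (d := 3) (Lc := Lc) j
  refine ⟨δ, (Lc : ℝ) ^ (5 * j) * C, hδ, by positivity, fun κ l p => ?_⟩
  have h := hK (-p) 0 (Sum.inl κ) (Sum.inr l)
  have hl : l1 ((-p) - 0) = l1 p := by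
    rw [sub_zero]; unfold B12Sec2to5.l1; simp only [Pi.neg_apply, Int.cast_neg, abs_neg]
  rw [hl] at h
  show |(Lc : ℝ) ^ (5 * j) * KInvStep (d := 3) Lc j (-p) 0 (Sum.inl κ) (Sum.inr l)| ≤ _
  rw [abs_mul, abs_of_nonneg (by positivity : (0 : ℝ) ≤ (Lc : ℝ) ^ (5 * j)), mul_assoc]
  exact mul_le_mul_of_nonneg_left h (by positivity)

variable (R : Roots Lc) (P : Pins)

/-- [folklore] the N-chart is invariant under the `Lc^(j+1)`-block translations, `+N•s` spelling (an2 `shiftK_AN`). -/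
theorem shiftK_AN_smul (j : ℕ) (s : Fin (3 + 1) → ℤ) : shiftK (((Lc ^ (j + 1) : ℕ) : ℤ) • s) (AN R j) = AN R j := by
  have h := shiftK_AN R j 0 (-s)
  rw [smul_neg, neg_neg] at h
  rw [AN_eq]; exact h

/-- [folklore] **BLOCK COVARIANCE OF an2's FIRST-ORDER FAMILY** `VN R P j` (`= vertexOfK (AN R j) (Lc^(j+1)) (JNat R P (j+1)).S`): the chart is block invariant (an2 `shiftK_AN`)
and the record's stencils are block covariant (`ChartStepJets.SchartOf_translate`), so lit `vertexOfK_translate_block` applies. -/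
theorem VN_translate (j : ℕ) (c : Fin (3 + 1)) (t s : Fin (3 + 1) → ℤ) :
    VN R P j c (t + s) = shiftK (-(((Lc ^ (j + 1) : ℕ) : ℤ) • s)) (VN R P j c t) := by
  rw [VN_eq]
  refine vertexOfK_translate_block (N := Lc ^ (j + 1)) (fun t' => ?_) (fun κ' u t' => ?_) c t s
  · rw [AN_eq]; exact shiftK_AN R j 0 t'
  · rw [JNat_S]
    exact SchartOf_translate (tabsComp (j + 1) (one_le_of_neZero Lc) R.hr (P.cM (j + 1))) (P.cE (j + 1)) (P.cVH (j + 1)) (P.cΛ (j + 1))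
      (shiftK_AN R j) 0 κ' u t'

/-- [folklore] **JOINT BLOCK COVARIANCE OF an2's SECOND-ORDER FAMILY** `WN R P j` (`= (JNat R P (j+1)).W`): `ChartStepJets.WchartOf_translate` at the record. -/
theorem WN_translate (j : ℕ) (c : Fin (3 + 1)) (t : Fin (3 + 1) → ℤ) (e : Fin (3 + 1)) (t' s : Fin (3 + 1) → ℤ) :
    WN R P j c (t + s) e (t' + s) = shiftK (-(((Lc ^ (j + 1) : ℕ) : ℤ) • s)) (WN R P j c t e t') := by
  rw [WN_eq, JNat_W]
  exact WchartOf_translate (tabsComp (j + 1) (one_le_of_neZero Lc) R.hr (P.cM (j + 1))) (P.cE (j + 1)) (P.cVH (j + 1)) (P.cΛ (j + 1))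
    (P.cE₂ (j + 1)) (P.cB (j + 1)) (P.T (j + 1)) (shiftK_AN R j) 0 c t e t' s

end Letters

/-! ## §2 THE TRANSPORT ROW AT THE RECORD -/

section Record

variable (Lc : ℕ) [NeZero Lc] (Pn : Pins) (uF : ℕ → ℝ)

/-- [folklore] **`htr` AT THE RECORD** — v10 `StepRecursionFeedNestedNamedI.d1Tel_JcComp_ctr_namedI`'s binder `htr` (L.277) CHARACTER FOR CHARACTER under
σ = {`(AF (j + 1))` ↦ `(scaleK (Sum.elim 1 (uF j)⁻¹) (Sum.elim 1 (uF j)⁻¹) (AN (Roots.ctr Lc) j))`,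
`(𝒱F (j + 1))` ↦ `(fun μ y => scaleK (Sum.elim 1 (uF j)) (Sum.elim 1 (uF j)) ((Lc : ℝ) ^ 4 • dressV (Lc ^ (j + 1)) Lc (wStep Lc (j + 1)) (VN (Roots.ctr Lc) Pn j) μ y))`,
`(𝒲F (j + 1))` ↦ `(fun μ y ν y' => scaleK (Sum.elim 1 (uF j)) (Sum.elim 1 (uF j)) ((Lc : ℝ) ^ 8 • dressW (Lc ^ (j + 1)) Lc (wStep Lc (j + 1)) (WN (Roots.ctr Lc) Pn j) μ y ν y'))`}:
the units cancel (`hessKer_scaleK`), `Lc⁴·Lc⁴` and `Lc⁸` leave bubble and tadpole, and FILE 2's `hessKer_dressV_dressW` at `N := Lc^(j+1)`, `L := Lc`, `w := wStep Lc (j+1)` fed the record's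
letters (§1 + an2 `decays_AN`, `vertexFamilies_VN_WN`) is the row. -/
theorem htr_rec (huF : ∀ j, uF j ≠ 0) : ∀ j : ℕ, 1 ≤ j → ∀ (μ ν : Fin 4) (z : Fin 4 → ℤ), hessKer (scaleK (Sum.elim (fun _ : Fin (3 + 1) => (1 : ℝ)) (fun _ : Fin (3 + 1) => (uF j)⁻¹)) (Sum.elim (fun _ : Fin (3 + 1) => (1 : ℝ)) (fun _ : Fin (3 + 1) => (uF j)⁻¹)) (AN (Roots.ctr Lc) j)) (fun μ y => scaleK (Sum.elim (fun _ : Fin (3 + 1) => (1 : ℝ)) (fun _ : Fin (3 + 1) => (uF j))) (Sum.elim (fun _ : Fin (3 + 1) => (1 : ℝ)) (fun _ : Fin (3 + 1) => (uF j))) ((Lc : ℝ) ^ 4 • dressV (Lc ^ (j + 1)) Lc (wStep Lc (j + 1)) (VN (Roots.ctr Lc) Pn j) μ y)) (fun μ y ν y' => scaleK (Sum.elim (fun _ : Fin (3 + 1) => (1 : ℝ)) (fun _ : Fin (3 + 1) => (uF j))) (Sum.elim (fun _ : Fin (3 + 1) => (1 : ℝ)) (fun _ : Fin (3 + 1) =>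 (uF j))) ((Lc : ℝ) ^ 8 • dressW (Lc ^ (j + 1)) Lc (wStep Lc (j + 1)) (WN (Roots.ctr Lc) Pn j) μ y ν y')) μ ν z = (Lc : ℝ) ^ 8 * dressedEntry (wStep Lc (j + 1)) (hessKer (AN (Roots.ctr Lc) j) (VN (Roots.ctr Lc) Pn j) (WN (Roots.ctr Lc) Pn j)) ((Lc : ℤ) • z) μ ν := by
  intro j _ μ ν z
  have hσσ : ∀ a : Fib 3, Sum.elim (fun _ : Fin (3 + 1) => (1 : ℝ)) (fun _ : Fin (3 + 1) => (uF j)⁻¹) a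
      * Sum.elim (fun _ : Fin (3 + 1) => (1 : ℝ)) (fun _ : Fin (3 + 1) => (uF j)) a = 1 := fun a => fibreScale_mul_inv (huF j) a
  rw [hessKer_scaleK _ _ hσσ (AN (Roots.ctr Lc) j)
    (fun μ y => (Lc : ℝ) ^ 4 • dressV (Lc ^ (j + 1)) Lc (wStep Lc (j + 1)) (VN (Roots.ctr Lc) Pn j) μ y)
    (fun μ y ν y' => (Lc : ℝ) ^ 8 • dressW (Lc ^ (j + 1)) Lc (wStep Lc (j + 1)) (WN (Roots.ctr Lc) Pn j) μ y ν y')]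
  -- the record's letters
  obtain ⟨δA, CA, hδA, -, hA⟩ := decays_AN (Roots.ctr Lc) j
  obtain ⟨Cv, Cw, δ, hδ, hV, hW⟩ := vertexFamilies_VN_WN (Roots.ctr Lc) Pn j
  obtain ⟨δw, Cw0, hδw, hCw0, hw⟩ := abs_wStep_le Lc (j + 1)
  have hid := hessKer_dressV_dressW (N := Lc ^ (j + 1)) Lc (w := wStep Lc (j + 1)) (A := AN (Roots.ctr Lc) j)
    (V := VN (Roots.ctr Lc) Pn j) (W := WN (Roots.ctr Lc) Pn j) ⟨CA, δA, hδA, hA⟩ (shiftK_AN_smul Lc (Roots.ctr Lc) j)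
    (fun c a u => hw c a u) hCw0 hδw hV hW hδ (VN_translate Lc (Roots.ctr Lc) Pn j) (WN_translate Lc (Roots.ctr Lc) Pn j) μ ν z
  rw [← hid]
  simp only [ExpKernelCalculus.hessKer]
  rw [tadpole_smul, bubble_smul_left, bubble_smul_right]
  ring

end Record

/-! ## §3 The dressed F-families ARE vertex families at blocking `Lc^(j+1)·Lc` (v10's `hVF hWF hδF` at the same σ, `∃`-form) -/

section Families

variable (Lc : ℕ) [NeZero Lc] (Pn : Pins) (uF : ℕ → ℝ)

/-- [folklore] **THE σ′-SCALED DRESSED FAMILIES ARE VERTEX FAMILIES** at blocking `Lc^(j+1)·Lc` with ONE common rate: FILE 1 §3 (`vertexFamily_dressV ∕ vertexFamily₂_dressW`)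
fed an2 `vertexFamilies_VN_WN` and §1 `abs_wStep_le`, then lit `biLoc_smul` (the powers of `Lc`) and lit `biLoc_scaleK` (`|σ′| ≤ uF j` for `1 ≤ uF j`, road
`TowerSigmaLegLetters.abs_fibSigma'_le`).  The END feeds `NF n := Lc^(n+1)·Lc`, `CvF CwF δF := Classical.choose …`, `hVF hWF hδF :=` the conjuncts. -/
theorem exists_vertexFamilies_FRec (huF : ∀ j, 1 ≤ uF j) (j : ℕ) : ∃ Cv Cw δ : ℝ, 0 < δ ∧
    VertexFamily (fun μ y => scaleK (Sum.elim (fun _ : Fin (3 + 1) => (1 : ℝ)) (fun _ : Fin (3 + 1) => (uF j))) (Sum.elim (fun _ : Fin (3 + 1) => (1 : ℝ)) (fun _ : Fin (3 + 1) => (uF j))) ((Lc : ℝ) ^ 4 • dressV (Lc ^ (j + 1)) Lc (wStep Lc (j + 1)) (VN (Roots.ctr Lc) Pn j) μ y)) (Lc ^ (j + 1) * Lc) Cv δ ∧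
    VertexFamily₂ (fun μ y ν y' => scaleK (Sum.elim (fun _ : Fin (3 + 1) => (1 : ℝ)) (fun _ : Fin (3 + 1) => (uF j))) (Sum.elim (fun _ : Fin (3 + 1) => (1 : ℝ)) (fun _ : Fin (3 + 1) => (uF j))) ((Lc : ℝ) ^ 8 • dressW (Lc ^ (j + 1)) Lc (wStep Lc (j + 1)) (WN (Roots.ctr Lc) Pn j) μ y ν y')) (Lc ^ (j + 1) * Lc) Cw δ := by
  obtain ⟨Cv, Cw, δ, hδ, hV, hW⟩ := vertexFamilies_VN_WN (Roots.ctr Lc) Pn j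
  obtain ⟨δw, Cw0, hδw, hCw0, hw⟩ := abs_wStep_le Lc (j + 1)
  have hV' := vertexFamily_dressV (N := Lc ^ (j + 1)) Lc (w := wStep Lc (j + 1)) (fun c a u => hw c a u) hCw0 hδw hV hδ
  have hW' := vertexFamily₂_dressW (N := Lc ^ (j + 1)) Lc (w := wStep Lc (j + 1)) (fun c a u => hw c a u) hCw0 hδw hW hδ
  have hNpos : (0 : ℝ) < ((Lc ^ (j + 1) : ℕ) : ℝ) := by exact_mod_cast Nat.pos_of_ne_zero (NeZero.ne (Lc ^ (j + 1)))
  have hm : 0 < min (δw / ((Lc ^ (j + 1) : ℕ) : ℝ)) δ := lt_min (div_pos hδw hNpos) hδ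
  have hs := fun a => abs_fibSigma'_le (d := 3) (huF j) a
  have hle : min (δw / ((Lc ^ (j + 1) : ℕ) : ℝ)) δ / 2 / 2 ≤ min (δw / ((Lc ^ (j + 1) : ℕ) : ℝ)) δ / 2 := by linarith [half_pos hm]
  have hV'' : VertexFamily (fun μ y => scaleK (Sum.elim (fun _ : Fin (3 + 1) => (1 : ℝ)) (fun _ : Fin (3 + 1) => (uF j)))
      (Sum.elim (fun _ : Fin (3 + 1) => (1 : ℝ)) (fun _ : Fin (3 + 1) => (uF j)))
      ((Lc : ℝ) ^ 4 • dressV (Lc ^ (j + 1)) Lc (wStep Lc (j + 1)) (VN (Roots.ctr Lc) Pn j) μ y)) (Lc ^ (j + 1) * Lc)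
      (uF j * (|(Lc : ℝ) ^ 4| * |∑ _c : Fin (3 + 1), Cw0 * |Cv| * ExpKernelCalculus.Zl (3 + 1) (min (δw / ((Lc ^ (j + 1) : ℕ) : ℝ)) δ / 2)|) * uF j)
      (min (δw / ((Lc ^ (j + 1) : ℕ) : ℝ)) δ / 2 / 2) :=
    fun μ y => biLoc_scaleK hs hs (biLoc_smul ((Lc : ℝ) ^ 4) (biLoc_of_le (hV' μ y) hle))
  have hW'' : VertexFamily₂ (fun μ y ν y' => scaleK (Sum.elim (fun _ : Fin (3 + 1) => (1 : ℝ)) (fun _ : Fin (3 + 1) => (uF j)))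
      (Sum.elim (fun _ : Fin (3 + 1) => (1 : ℝ)) (fun _ : Fin (3 + 1) => (uF j)))
      ((Lc : ℝ) ^ 8 • dressW (Lc ^ (j + 1)) Lc (wStep Lc (j + 1)) (WN (Roots.ctr Lc) Pn j) μ y ν y')) (Lc ^ (j + 1) * Lc)
      (uF j * (|(Lc : ℝ) ^ 8| * (∑ _c : Fin (3 + 1), ∑ _e : Fin (3 + 1),
        Cw0 * (Cw0 * |Cw| * ExpKernelCalculus.Zl (3 + 1) (min (δw / ((Lc ^ (j + 1) : ℕ) : ℝ)) δ / 2))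
          * ExpKernelCalculus.Zl (3 + 1) (min (δw / ((Lc ^ (j + 1) : ℕ) : ℝ)) δ / 2 / 2))) * uF j)
      (min (δw / ((Lc ^ (j + 1) : ℕ) : ℝ)) δ / 2 / 2) :=
    fun μ y ν y' => biLoc_scaleK hs hs (biLoc_smul ((Lc : ℝ) ^ 8) (hW' μ y ν y'))
  exact ⟨_, _, _, half_pos (half_pos hm), hV'', hW''⟩

end Families

end Summit.QuantumFields.BalabanUV.Beta.FP.TowerFTransportRow

end
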